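import Summits.CriticalPhenomena.SAWScalingLimit.Theorems.SAWTotalPositivityBoundaryTP2Defs
import Summits.CriticalPhenomena.SAWScalingLimit.Theorems.SAWTotalPositivityBoundaryTP2Kernel
import Summits.CriticalPhenomena.SAWScalingLimit.Theorems.SAWTotalPositivityBoundaryTP2LadderRung
import Summits.CriticalPhenomena.SAWScalingLimit.Theorems.SAWTotalPositivityBoundaryTP2LadderKernelsInterior
import Summits.CriticalPhenomena.SAWScalingLimit.Theorems.EdgeOfPositivity.Negative.EdgeOfPositivityRectDomain
import HarnessLib

/-!
# Crux `BoundaryTP2` (stmt-CriticalPhenomena-7115), line `Sketch`: three bottom sites and the top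
site above the third on a ladder, crossing pairing vs adjacent pairing

Tool stub `stub_ladder_bbbt_rung_adjacent` of the line's skeleton: on the ladder
`R_L = discreteDomainGraph (rectDomain L 1) 1` (sites `{0..L} × {0,1}`), for bottom sites
`(c₁,0), (c₂,0), (c₃,0)`, `c₁ < c₂ < c₃ ≤ L`, the top site `(c₃,1)` above the third, and every
fugacity `0 ≤ x ≤ 1/2`, the crossing pairing weighs at most the adjacent one:

  `Z((c₁,0),(c₃,0)) Z((c₂,0),(c₃,1)) ≤ Z((c₁,0),(c₂,0)) Z((c₃,0),(c₃,1))`,  `Z = pathKernel R_L x`.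

Proof. Write `E_k = Σ_{d<k} x^{2d+3}`, `P = 1 + x`, `M = 1 - x`. The landed kernels give
`Z((c,0),(c,1)) = x + E_c + E_{L-c}` (`stub_ladderRung`) and, for `i + m + 1 = j`
(`stub_ladderKernels_interior`),

  `Z((i,0),(j,0)) = x^{m+1}/2 · [(P^{m+2} + M^{m+2}) + (E_i + E_{L-j})(P^{m+1} - M^{m+1})
      + E_i E_{L-j} (P^m + M^m)]`   (`rungAdj_kernel_same`),
  `Z((i,0),(j,1)) = x^{m+1}/2 · [(P^{m+2} - M^{m+2}) + (E_i + E_{L-j})(P^{m+1} + M^{m+1})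
      + E_i E_{L-j} (P^m - M^m)]`   (`rungAdj_kernel_cross`).

The claim is the product of two one-factor inequalities.
* `Z((c₁,0),(c₃,0)) ≤ Z((c₁,0),(c₂,0))`: the same-row kernel from a fixed site is non-increasing in
  the span. Indeed on `[0, 1/2]` one has the one-step bounds `x (P^{n+1} + M^{n+1}) ≤ P^n + M^n`
  (`x + x² ≤ 1`) and `x (P^{n+2} - M^{n+2}) ≤ P^{n+1} - M^{n+1}` (`tanh`-type bound and `2x ≤ 1`),
  so each of the three zigzag terms decreases when `m ↦ m + 1` (`rungAdj_same_step`), while the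
  coefficient `E_{L-j}` decreases with `j` (`E_k` is monotone in `k`) and `E_i = E_{c₁}` is fixed
  (`rungAdj_same_mono`, `rungAdj_same_le`).
* `Z((c₂,0),(c₃,1)) ≤ x + E_{c₂} + E_{L-c₃} ≤ x + E_{c₃} + E_{L-c₃} = Z((c₃,0),(c₃,1))`: the first
  bound is the crossing-kernel estimate `C ≤ 2x² + x(e + f) + x³ e f ≤ x + e + f`
  (`rungAdj_cross_le`, from the monotone sequences `x^n (P^{n+1} - M^{n+1})`, `x^n (P^n + M^n)`),
  the second is `E_{c₂} ≤ E_{c₃}`.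
All real forms are `≥ 0`, so the bounds multiply (`ENNReal.ofReal_mul`, `ENNReal.ofReal_le_ofReal`).
-/

noncomputable section

namespace Summit.CriticalPhenomena.SAWScalingLimit.Theorems.BoundaryTP2

open Literature.Probability.LatticeModels Literature.Probability.RandomPlanarGeometry
open Summit.CriticalPhenomena.SAWScalingLimit.Theorems.EdgeOfPositivity.Negative
open scoped ENNReal

/-! ## The excursion sums `E_k = Σ_{d<k} x^{2d+3}` (adapted from `…LadderFacingRungs`) -/

/-- `E_k ≥ 0` for `x ≥ 0`. [folklore] -/
private theorem rungAdj_E_nonneg {x : ℝ} (hx : 0 ≤ x) (k : ℕ) :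
    0 ≤ ∑ d ∈ Finset.range k, x ^ (2 * d + 3) :=
  Finset.sum_nonneg fun _ _ => pow_nonneg hx _

/-- Telescoping: `E_k (1 - x²) + x^{2k+3} = x³`. [folklore] -/
private theorem rungAdj_E_telescope (x : ℝ) (k : ℕ) :
    (∑ d ∈ Finset.range k, x ^ (2 * d + 3)) * (1 - x ^ 2) + x ^ (2 * k + 3) = x ^ 3 := by
  induction k with
  | zero => simp
  | succ k ih =>
    rw [Finset.sum_range_succ]
    linear_combination ih

/-- `E_k ≤ 1/6` for `0 ≤ x ≤ 1/2` (from `E_k (1 - x²) ≤ x³ ≤ 1/8` and `1 - x² ≥ 3/4`).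
[folklore] -/
private theorem rungAdj_E_le {x : ℝ} (hx0 : 0 ≤ x) (hx : x ≤ 1 / 2) (k : ℕ) :
    ∑ d ∈ Finset.range k, x ^ (2 * d + 3) ≤ 1 / 6 := by
  have h := rungAdj_E_telescope x k
  have hE := rungAdj_E_nonneg hx0 k
  have hk : 0 ≤ x ^ (2 * k + 3) := pow_nonneg hx0 _
  have hx2 : x ^ 2 ≤ (1 / 2) ^ 2 := pow_le_pow_left₀ hx0 hx 2
  have hx3 : x ^ 3 ≤ (1 / 2) ^ 3 := pow_le_pow_left₀ hx0 hx 3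
  norm_num at hx2 hx3
  nlinarith [mul_nonneg hE (by linarith : (0 : ℝ) ≤ 1 / 4 - x ^ 2)]

/-- `E_k` is monotone in `k` for `x ≥ 0`. [folklore] -/
private theorem rungAdj_E_mono {x : ℝ} (hx : 0 ≤ x) {k l : ℕ} (hkl : k ≤ l) :
    ∑ d ∈ Finset.range k, x ^ (2 * d + 3) ≤ ∑ d ∈ Finset.range l, x ^ (2 * d + 3) :=
  Finset.sum_le_sum_of_subset_of_nonneg (Finset.range_mono hkl) fun _ _ _ => pow_nonneg hx _

/-! ## The zigzag factors `P^n ± M^n`, `P = 1 + x`, `M = 1 - x` -/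

/-- `P^n - M^n ≥ 0` for `0 ≤ x ≤ 1`. [folklore] -/
private theorem rungAdj_D_nonneg {x : ℝ} (n : ℕ) (hx0 : 0 ≤ x) (hx1 : x ≤ 1) :
    0 ≤ (1 + x) ^ n - (1 - x) ^ n :=
  sub_nonneg.2 (pow_le_pow_left₀ (by linarith) (by linarith) n)

/-- `P^n + M^n ≥ 0` for `0 ≤ x ≤ 1`. [folklore] -/
private theorem rungAdj_S_nonneg {x : ℝ} (n : ℕ) (hx0 : 0 ≤ x) (hx1 : x ≤ 1) :
    0 ≤ (1 + x) ^ n + (1 - x) ^ n :=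
  add_nonneg (pow_nonneg (by linarith) n) (pow_nonneg (by linarith) n)

/-- `tanh`-type bound: `x (P^{k+1} + M^{k+1}) ≤ P^{k+1} - M^{k+1}` for `0 ≤ x ≤ 1` (the difference
is `(1-x)(1+x)(P^k - M^k) ≥ 0`). [folklore] -/
private theorem rungAdj_tanh {x : ℝ} (k : ℕ) (hx0 : 0 ≤ x) (hx1 : x ≤ 1) :
    x * ((1 + x) ^ (k + 1) + (1 - x) ^ (k + 1)) ≤ (1 + x) ^ (k + 1) - (1 - x) ^ (k + 1) := by
  -- adapted from `…BoundaryTP2LadderFacingRungs` (`facing_tanh`)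
  have h0 : 0 ≤ (1 - x) * (1 + x) * ((1 + x) ^ k - (1 - x) ^ k) :=
    mul_nonneg (mul_nonneg (by linarith) (by linarith)) (rungAdj_D_nonneg k hx0 hx1)
  have key : (1 + x) ^ (k + 1) - (1 - x) ^ (k + 1) - x * ((1 + x) ^ (k + 1) + (1 - x) ^ (k + 1)) =
      (1 - x) * (1 + x) * ((1 + x) ^ k - (1 - x) ^ k) := by ring
  linarith [key, h0]

/-- One-step bound for the difference sequence: `x (P^{n+2} - M^{n+2}) ≤ P^{n+1} - M^{n+1}` on
`[0, 1/2]` (`P^{n+2} - M^{n+2} = (P^{n+1} - M^{n+1}) + x (P^{n+1} + M^{n+1})`, `rungAdj_tanh`,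
`2x ≤ 1`). [folklore] -/
private theorem rungAdj_coreA {x : ℝ} (n : ℕ) (hx0 : 0 ≤ x) (hx : x ≤ 1 / 2) :
    x * ((1 + x) ^ (n + 2) - (1 - x) ^ (n + 2)) ≤ (1 + x) ^ (n + 1) - (1 - x) ^ (n + 1) := by
  -- adapted from `…BoundaryTP2LadderFacingRungs` (`facing_A_step`)
  have hD := rungAdj_D_nonneg (n + 1) hx0 (by linarith)
  have ht := rungAdj_tanh n hx0 (by linarith)
  have e : (1 + x) ^ (n + 2) - (1 - x) ^ (n + 2) =
      ((1 + x) ^ (n + 1) - (1 - x) ^ (n + 1)) + x * ((1 + x) ^ (n + 1) + (1 - x) ^ (n + 1)) := by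
    ring
  rw [e]
  nlinarith [mul_le_mul_of_nonneg_left ht hx0, mul_nonneg (by linarith : (0 : ℝ) ≤ 1 - 2 * x) hD]

/-- One-step bound for the sum sequence: `x (P^{n+1} + M^{n+1}) ≤ P^n + M^n` on `[0, 1/2]`
(`P^{n+1} + M^{n+1} = (P^n + M^n) + x (P^n - M^n)` and `x + x² ≤ 1`). [folklore] -/
private theorem rungAdj_coreB {x : ℝ} (n : ℕ) (hx0 : 0 ≤ x) (hx : x ≤ 1 / 2) :
    x * ((1 + x) ^ (n + 1) + (1 - x) ^ (n + 1)) ≤ (1 + x) ^ n + (1 - x) ^ n := by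
  -- adapted from `…BoundaryTP2LadderFacingRungs` (`facing_B_step`)
  have hM : 0 ≤ (1 - x) ^ n := pow_nonneg (by linarith) n
  have hP : 0 ≤ (1 + x) ^ n := pow_nonneg (by linarith) n
  have e : (1 + x) ^ (n + 1) + (1 - x) ^ (n + 1) =
      ((1 + x) ^ n + (1 - x) ^ n) + x * ((1 + x) ^ n - (1 - x) ^ n) := by ring
  rw [e]
  nlinarith [mul_le_mul_of_nonneg_right hx hP, mul_le_mul_of_nonneg_right hx hM,
    mul_le_mul_of_nonneg_right hx (mul_nonneg hx0 hP), mul_nonneg hx0 (mul_nonneg hx0 hM)]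

/-- The difference sequence is non-increasing:
`x^{n+1} (P^{n+2} - M^{n+2}) ≤ x^n (P^{n+1} - M^{n+1})` on `[0, 1/2]`. [folklore] -/
private theorem rungAdj_A_step {x : ℝ} (n : ℕ) (hx0 : 0 ≤ x) (hx : x ≤ 1 / 2) :
    x ^ (n + 1) * ((1 + x) ^ (n + 2) - (1 - x) ^ (n + 2)) ≤
      x ^ n * ((1 + x) ^ (n + 1) - (1 - x) ^ (n + 1)) :=
  calc x ^ (n + 1) * ((1 + x) ^ (n + 2) - (1 - x) ^ (n + 2))
      = x ^ n * (x * ((1 + x) ^ (n + 2) - (1 - x) ^ (n + 2))) := by ring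
    _ ≤ x ^ n * ((1 + x) ^ (n + 1) - (1 - x) ^ (n + 1)) :=
        mul_le_mul_of_nonneg_left (rungAdj_coreA n hx0 hx) (pow_nonneg hx0 n)

/-- The sum sequence is non-increasing: `x^{n+1} (P^{n+1} + M^{n+1}) ≤ x^n (P^n + M^n)` on
`[0, 1/2]`. [folklore] -/
private theorem rungAdj_B_step {x : ℝ} (n : ℕ) (hx0 : 0 ≤ x) (hx : x ≤ 1 / 2) :
    x ^ (n + 1) * ((1 + x) ^ (n + 1) + (1 - x) ^ (n + 1)) ≤ x ^ n * ((1 + x) ^ n + (1 - x) ^ n) :=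
  calc x ^ (n + 1) * ((1 + x) ^ (n + 1) + (1 - x) ^ (n + 1))
      = x ^ n * (x * ((1 + x) ^ (n + 1) + (1 - x) ^ (n + 1))) := by ring
    _ ≤ x ^ n * ((1 + x) ^ n + (1 - x) ^ n) :=
        mul_le_mul_of_nonneg_left (rungAdj_coreB n hx0 hx) (pow_nonneg hx0 n)

/-- Difference sequence from `n = 0`: `x^n (P^{n+1} - M^{n+1}) ≤ 2x` on `[0, 1/2]`. [folklore] -/
private theorem rungAdj_A_le₀ {x : ℝ} (n : ℕ) (hx0 : 0 ≤ x) (hx : x ≤ 1 / 2) :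
    x ^ n * ((1 + x) ^ (n + 1) - (1 - x) ^ (n + 1)) ≤ 2 * x := by
  induction n with
  | zero => apply le_of_eq; ring
  | succ n ih => exact (rungAdj_A_step n hx0 hx).trans ih

/-- Difference sequence from `n = 1`: `x^{n+1} (P^{n+2} - M^{n+2}) ≤ 4x²` on `[0, 1/2]`.
[folklore] -/
private theorem rungAdj_A_le₁ {x : ℝ} (n : ℕ) (hx0 : 0 ≤ x) (hx : x ≤ 1 / 2) :
    x ^ (n + 1) * ((1 + x) ^ (n + 2) - (1 - x) ^ (n + 2)) ≤ 4 * x ^ 2 := by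
  induction n with
  | zero => apply le_of_eq; ring
  | succ n ih => exact (rungAdj_A_step (n + 1) hx0 hx).trans ih

/-- Sum sequence from `n = 1`: `x^{n+1} (P^{n+1} + M^{n+1}) ≤ 2x` on `[0, 1/2]`. [folklore] -/
private theorem rungAdj_B_le {x : ℝ} (n : ℕ) (hx0 : 0 ≤ x) (hx : x ≤ 1 / 2) :
    x ^ (n + 1) * ((1 + x) ^ (n + 1) + (1 - x) ^ (n + 1)) ≤ 2 * x := by
  induction n with
  | zero => apply le_of_eq; ring
  | succ n ih => exact (rungAdj_B_step (n + 1) hx0 hx).trans ih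

/-- The third crossing factor: `x^{m+1} (P^m - M^m) ≤ 2x³` on `[0, 1/2]` (zero for `m = 0`, else
`x²` times the difference sequence). [folklore] -/
private theorem rungAdj_G_le {x : ℝ} (m : ℕ) (hx0 : 0 ≤ x) (hx : x ≤ 1 / 2) :
    x ^ (m + 1) * ((1 + x) ^ m - (1 - x) ^ m) ≤ 2 * x ^ 3 := by
  cases m with
  | zero => simp only [pow_zero, sub_self, mul_zero]; positivity
  | succ k =>
    calc x ^ (k + 1 + 1) * ((1 + x) ^ (k + 1) - (1 - x) ^ (k + 1))
        = x ^ 2 * (x ^ k * ((1 + x) ^ (k + 1) - (1 - x) ^ (k + 1))) := by ring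
      _ ≤ x ^ 2 * (2 * x) := mul_le_mul_of_nonneg_left (rungAdj_A_le₀ k hx0 hx) (pow_nonneg hx0 2)
      _ = 2 * x ^ 3 := by ring

/-! ## The crossing kernel's real form (second factor) -/

/-- The real form of a crossing kernel is nonnegative (`0 ≤ x ≤ 1`, `e, f ≥ 0`). [folklore] -/
private theorem rungAdj_cross_nonneg {x e f : ℝ} (m : ℕ) (hx0 : 0 ≤ x) (hx1 : x ≤ 1) (he : 0 ≤ e)
    (hf : 0 ≤ f) :
    0 ≤ x ^ (m + 1) / 2 * (((1 + x) ^ (m + 2) - (1 - x) ^ (m + 2)) +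
      (e + f) * ((1 + x) ^ (m + 1) + (1 - x) ^ (m + 1)) + e * f * ((1 + x) ^ m - (1 - x) ^ m)) :=
  mul_nonneg (by positivity) (add_nonneg (add_nonneg (rungAdj_D_nonneg (m + 2) hx0 hx1)
    (mul_nonneg (add_nonneg he hf) (rungAdj_S_nonneg (m + 1) hx0 hx1)))
    (mul_nonneg (mul_nonneg he hf) (rungAdj_D_nonneg m hx0 hx1)))

/-- The crossing kernel's real form is at most `x + e + f` for `0 ≤ x ≤ 1/2`, `0 ≤ e ≤ 1/6`,
`0 ≤ f`: `C ≤ 2x² + x (e + f) + x³ e f ≤ x + e + f`. [folklore] -/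
private theorem rungAdj_cross_le {x e f : ℝ} (m : ℕ) (hx0 : 0 ≤ x) (hx : x ≤ 1 / 2) (he : 0 ≤ e)
    (he' : e ≤ 1 / 6) (hf : 0 ≤ f) :
    x ^ (m + 1) / 2 * (((1 + x) ^ (m + 2) - (1 - x) ^ (m + 2)) +
      (e + f) * ((1 + x) ^ (m + 1) + (1 - x) ^ (m + 1)) + e * f * ((1 + x) ^ m - (1 - x) ^ m)) ≤
      x + e + f := by
  -- adapted from `…BoundaryTP2LadderFacingRungs` (`facing_cross_le`)
  have hA := rungAdj_A_le₁ m hx0 hx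
  have hB := rungAdj_B_le m hx0 hx
  have hG := rungAdj_G_le m hx0 hx
  have hx3 : x ^ 3 ≤ (1 / 2) ^ 3 := pow_le_pow_left₀ hx0 hx 3
  norm_num at hx3
  have hef : 0 ≤ e * f := mul_nonneg he hf
  have e1 : x ^ (m + 1) / 2 * (((1 + x) ^ (m + 2) - (1 - x) ^ (m + 2)) +
      (e + f) * ((1 + x) ^ (m + 1) + (1 - x) ^ (m + 1)) + e * f * ((1 + x) ^ m - (1 - x) ^ m)) =
      (x ^ (m + 1) * ((1 + x) ^ (m + 2) - (1 - x) ^ (m + 2)) +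
        (e + f) * (x ^ (m + 1) * ((1 + x) ^ (m + 1) + (1 - x) ^ (m + 1))) +
        e * f * (x ^ (m + 1) * ((1 + x) ^ m - (1 - x) ^ m))) / 2 := by ring
  rw [e1]
  have t2 : (e + f) * (x ^ (m + 1) * ((1 + x) ^ (m + 1) + (1 - x) ^ (m + 1))) ≤ (e + f) * (2 * x) :=
    mul_le_mul_of_nonneg_left hB (add_nonneg he hf)
  have t3 : e * f * (x ^ (m + 1) * ((1 + x) ^ m - (1 - x) ^ m)) ≤ e * f * (2 * x ^ 3) :=
    mul_le_mul_of_nonneg_left hG hef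
  have u1 : 4 * x ^ 2 ≤ 2 * x := by nlinarith [mul_nonneg hx0 (by linarith : (0 : ℝ) ≤ 1 - 2 * x)]
  have u2 : (e + f) * (2 * x) ≤ (e + f) * 1 :=
    mul_le_mul_of_nonneg_left (by linarith) (add_nonneg he hf)
  have u3 : e * f * (2 * x ^ 3) ≤ e * f * (1 / 4) := mul_le_mul_of_nonneg_left (by linarith) hef
  have u4 : e * f ≤ 1 / 6 * f := mul_le_mul_of_nonneg_right he' hf
  linarith

/-! ## The same-row kernel's real form (first factor) -/

/-- The real form of a same-row kernel is nonnegative (`0 ≤ x ≤ 1`, `e, f ≥ 0`). [folklore] -/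
private theorem rungAdj_same_nonneg {x e f : ℝ} (m : ℕ) (hx0 : 0 ≤ x) (hx1 : x ≤ 1) (he : 0 ≤ e)
    (hf : 0 ≤ f) :
    0 ≤ x ^ (m + 1) / 2 * (((1 + x) ^ (m + 2) + (1 - x) ^ (m + 2)) +
      (e + f) * ((1 + x) ^ (m + 1) - (1 - x) ^ (m + 1)) + e * f * ((1 + x) ^ m + (1 - x) ^ m)) :=
  mul_nonneg (by positivity) (add_nonneg (add_nonneg (rungAdj_S_nonneg (m + 2) hx0 hx1)
    (mul_nonneg (add_nonneg he hf) (rungAdj_D_nonneg (m + 1) hx0 hx1)))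
    (mul_nonneg (mul_nonneg he hf) (rungAdj_S_nonneg m hx0 hx1)))

/-- The same-row real form is non-increasing in the span: each zigzag term decreases when
`m ↦ m + 1` (`rungAdj_coreB`, `rungAdj_coreA`, `rungAdj_coreB`), the coefficients `e + f`, `e f`
being nonnegative. [folklore] -/
private theorem rungAdj_same_step {x e f : ℝ} (m : ℕ) (hx0 : 0 ≤ x) (hx : x ≤ 1 / 2) (he : 0 ≤ e)
    (hf : 0 ≤ f) :
    x ^ (m + 1 + 1) / 2 * (((1 + x) ^ (m + 1 + 2) + (1 - x) ^ (m + 1 + 2)) +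
        (e + f) * ((1 + x) ^ (m + 1 + 1) - (1 - x) ^ (m + 1 + 1)) +
        e * f * ((1 + x) ^ (m + 1) + (1 - x) ^ (m + 1))) ≤
      x ^ (m + 1) / 2 * (((1 + x) ^ (m + 2) + (1 - x) ^ (m + 2)) +
        (e + f) * ((1 + x) ^ (m + 1) - (1 - x) ^ (m + 1)) +
        e * f * ((1 + x) ^ m + (1 - x) ^ m)) := by
  have hB2 := rungAdj_coreB (m + 2) hx0 hx
  have hA := rungAdj_coreA m hx0 hx
  have hB0 := rungAdj_coreB m hx0 hx
  have e1 : x ^ (m + 1 + 1) / 2 * (((1 + x) ^ (m + 1 + 2) + (1 - x) ^ (m + 1 + 2)) +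
        (e + f) * ((1 + x) ^ (m + 1 + 1) - (1 - x) ^ (m + 1 + 1)) +
        e * f * ((1 + x) ^ (m + 1) + (1 - x) ^ (m + 1))) =
      x ^ (m + 1) / 2 * (x * ((1 + x) ^ (m + 2 + 1) + (1 - x) ^ (m + 2 + 1)) +
        (e + f) * (x * ((1 + x) ^ (m + 2) - (1 - x) ^ (m + 2))) +
        e * f * (x * ((1 + x) ^ (m + 1) + (1 - x) ^ (m + 1)))) := by ring
  rw [e1]
  refine mul_le_mul_of_nonneg_left ?_ (by positivity)
  have t2 : (e + f) * (x * ((1 + x) ^ (m + 2) - (1 - x) ^ (m + 2))) ≤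
      (e + f) * ((1 + x) ^ (m + 1) - (1 - x) ^ (m + 1)) :=
    mul_le_mul_of_nonneg_left hA (add_nonneg he hf)
  have t3 : e * f * (x * ((1 + x) ^ (m + 1) + (1 - x) ^ (m + 1))) ≤
      e * f * ((1 + x) ^ m + (1 - x) ^ m) :=
    mul_le_mul_of_nonneg_left hB0 (mul_nonneg he hf)
  linarith

/-- The same-row real form is non-decreasing in the far coefficient `f` (`0 ≤ x ≤ 1`, `e ≥ 0`).
[folklore] -/
private theorem rungAdj_same_mono {x e f f' : ℝ} (m : ℕ) (hx0 : 0 ≤ x) (hx1 : x ≤ 1) (he : 0 ≤ e)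
    (hff : f' ≤ f) :
    x ^ (m + 1) / 2 * (((1 + x) ^ (m + 2) + (1 - x) ^ (m + 2)) +
        (e + f') * ((1 + x) ^ (m + 1) - (1 - x) ^ (m + 1)) + e * f' * ((1 + x) ^ m + (1 - x) ^ m)) ≤
      x ^ (m + 1) / 2 * (((1 + x) ^ (m + 2) + (1 - x) ^ (m + 2)) +
        (e + f) * ((1 + x) ^ (m + 1) - (1 - x) ^ (m + 1)) +
        e * f * ((1 + x) ^ m + (1 - x) ^ m)) := by
  refine mul_le_mul_of_nonneg_left ?_ (by positivity)
  have hD := rungAdj_D_nonneg (m + 1) hx0 hx1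
  have hS := mul_nonneg he (rungAdj_S_nonneg m hx0 hx1)
  nlinarith [mul_le_mul_of_nonneg_right hff hD, mul_le_mul_of_nonneg_right hff hS]

/-- **First factor.** The same-row real form with span `n + 1 ≥ m + 1` and far coefficient
`f' ≤ f` is at most the one with span `m + 1` and far coefficient `f` (induction on `n` from
`rungAdj_same_mono` and `rungAdj_same_step`). [folklore] -/
private theorem rungAdj_same_le {x e f f' : ℝ} (hx0 : 0 ≤ x) (hx : x ≤ 1 / 2) (he : 0 ≤ e)
    (hf' : 0 ≤ f') (hff : f' ≤ f) {m n : ℕ} (hmn : m ≤ n) :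
    x ^ (n + 1) / 2 * (((1 + x) ^ (n + 2) + (1 - x) ^ (n + 2)) +
        (e + f') * ((1 + x) ^ (n + 1) - (1 - x) ^ (n + 1)) + e * f' * ((1 + x) ^ n + (1 - x) ^ n)) ≤
      x ^ (m + 1) / 2 * (((1 + x) ^ (m + 2) + (1 - x) ^ (m + 2)) +
        (e + f) * ((1 + x) ^ (m + 1) - (1 - x) ^ (m + 1)) +
        e * f * ((1 + x) ^ m + (1 - x) ^ m)) := by
  induction n, hmn using Nat.le_induction with
  | base => exact rungAdj_same_mono m hx0 (by linarith) he hff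
  | succ n _ ih => exact (rungAdj_same_step n hx0 hx he hf').trans ih

/-! ## The real inequality -/

/-- The real inequality behind the stub, in the variables `e₁ = E_{c₁}`, `e₂ = E_{c₂}`,
`e₃ = E_{c₃}`, `f₂ = E_{L-c₂}`, `f₃ = E_{L-c₃}`, spans `c₂ - c₁ = u + 1`, `c₃ - c₂ = m + 1`
(so `c₃ - c₁ = (u + m + 1) + 1`): `S₁₃ T₂₃ ≤ S₁₂ (x + e₃ + f₃)` from `S₁₃ ≤ S₁₂`
(`rungAdj_same_le`, `f₃ ≤ f₂`) and `T₂₃ ≤ x + e₂ + f₃ ≤ x + e₃ + f₃` (`rungAdj_cross_le`,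
`e₂ ≤ e₃`). [folklore] -/
private theorem rungAdj_real {x e₁ e₂ e₃ f₂ f₃ : ℝ} (u m : ℕ) (hx0 : 0 ≤ x) (hx : x ≤ 1 / 2)
    (he₁ : 0 ≤ e₁) (he₂ : 0 ≤ e₂) (he₂' : e₂ ≤ 1 / 6) (hf₂ : 0 ≤ f₂) (hf₃ : 0 ≤ f₃)
    (h₂₃ : e₂ ≤ e₃) (h₃₂ : f₃ ≤ f₂) :
    x ^ (u + m + 1 + 1) / 2 * (((1 + x) ^ (u + m + 1 + 2) + (1 - x) ^ (u + m + 1 + 2)) +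
          (e₁ + f₃) * ((1 + x) ^ (u + m + 1 + 1) - (1 - x) ^ (u + m + 1 + 1)) +
          e₁ * f₃ * ((1 + x) ^ (u + m + 1) + (1 - x) ^ (u + m + 1))) *
        (x ^ (m + 1) / 2 * (((1 + x) ^ (m + 2) - (1 - x) ^ (m + 2)) +
          (e₂ + f₃) * ((1 + x) ^ (m + 1) + (1 - x) ^ (m + 1)) +
          e₂ * f₃ * ((1 + x) ^ m - (1 - x) ^ m))) ≤
      x ^ (u + 1) / 2 * (((1 + x) ^ (u + 2) + (1 - x) ^ (u + 2)) +
          (e₁ + f₂) * ((1 + x) ^ (u + 1) - (1 - x) ^ (u + 1)) +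
          e₁ * f₂ * ((1 + x) ^ u + (1 - x) ^ u)) *
        (x + e₃ + f₃) := by
  have hS := rungAdj_same_le hx0 hx he₁ hf₃ h₃₂ (show u ≤ u + m + 1 by omega)
  have hC0 := rungAdj_cross_nonneg m hx0 (by linarith) he₂ hf₃
  have hC := rungAdj_cross_le m hx0 hx he₂ he₂' hf₃
  have hS0 := rungAdj_same_nonneg u hx0 (by linarith) he₁ hf₂
  exact mul_le_mul hS (hC.trans (by linarith)) hC0 hS0

/-! ## The ladder kernels in zigzag form -/

/-- Same-row (bottom) kernels of the ladder `{0..L}×{0,1}` in zigzag form: for `i + m + 1 = j ≤ L`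
and `x ≥ 0`,
`Z_{R_L}((i,0),(j,0)) = x^{m+1}/2 · [(P^{m+2} + M^{m+2}) + (E_i + E_{L-j})(P^{m+1} - M^{m+1})`
`  + E_i E_{L-j} (P^m + M^m)]`, `P = 1+x`, `M = 1-x` (`stub_ladderKernels_interior` with `ε = +1`).
[folklore] -/
private theorem rungAdj_kernel_same (L i j m : ℕ) (hm : i + m + 1 = j) (hjL : j ≤ L) {x : ℝ}
    (hx : 0 ≤ x) :
    pathKernel (discreteDomainGraph (rectDomain L 1) 1) x (st i 0) (st j 0) =
      ENNReal.ofReal (x ^ (m + 1) / 2 *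
        (((1 + x) ^ (m + 2) + (1 - x) ^ (m + 2)) +
          ((∑ d ∈ Finset.range i, x ^ (2 * d + 3)) + ∑ d ∈ Finset.range (L - j), x ^ (2 * d + 3)) *
            ((1 + x) ^ (m + 1) - (1 - x) ^ (m + 1)) +
          (∑ d ∈ Finset.range i, x ^ (2 * d + 3)) * (∑ d ∈ Finset.range (L - j), x ^ (2 * d + 3)) *
            ((1 + x) ^ m + (1 - x) ^ m))) := by
  rw [stub_ladderKernels_interior L i j (by omega) hjL hx 0 0 (Or.inl rfl) (Or.inl rfl), if_pos rfl]
  congr 1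
  subst hm
  have e1 : i + m + 1 - i = m + 1 := by omega
  have e2 : m + 1 - 1 = m := rfl
  rw [e1, e2]
  ring

/-- Opposite-row kernels of the ladder `{0..L}×{0,1}` in zigzag form: for `i + m + 1 = j ≤ L` and
`x ≥ 0`,
`Z_{R_L}((i,0),(j,1)) = x^{m+1}/2 · [(P^{m+2} - M^{m+2}) + (E_i + E_{L-j})(P^{m+1} + M^{m+1})`
`  + E_i E_{L-j} (P^m - M^m)]` (`stub_ladderKernels_interior` with `ε = -1`; adapted from
`…BoundaryTP2LadderFacingRungs`, `facing_kernel`). [folklore] -/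
private theorem rungAdj_kernel_cross (L i j m : ℕ) (hm : i + m + 1 = j) (hjL : j ≤ L) {x : ℝ}
    (hx : 0 ≤ x) :
    pathKernel (discreteDomainGraph (rectDomain L 1) 1) x (st i 0) (st j 1) =
      ENNReal.ofReal (x ^ (m + 1) / 2 *
        (((1 + x) ^ (m + 2) - (1 - x) ^ (m + 2)) +
          ((∑ d ∈ Finset.range i, x ^ (2 * d + 3)) + ∑ d ∈ Finset.range (L - j), x ^ (2 * d + 3)) *
            ((1 + x) ^ (m + 1) + (1 - x) ^ (m + 1)) +
          (∑ d ∈ Finset.range i, x ^ (2 * d + 3)) * (∑ d ∈ Finset.range (L - j), x ^ (2 * d + 3)) *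
            ((1 + x) ^ m - (1 - x) ^ m))) := by
  rw [stub_ladderKernels_interior L i j (by omega) hjL hx 0 1 (Or.inl rfl) (Or.inr rfl),
    if_neg (by norm_num)]
  congr 1
  subst hm
  have e1 : i + m + 1 - i = m + 1 := by omega
  have e2 : m + 1 - 1 = m := rfl
  rw [e1, e2]
  ring

/-! ## The stub -/

/-- **Tool stub `stub_ladder_bbbt_rung_adjacent`.** On the ladder `{0..L}×{0,1}`, for three bottom
sites `c₁ < c₂ < c₃ ≤ L` and the top site `(c₃,1)` above the third (cyclic order
`(c₁,0),(c₂,0),(c₃,0),(c₃,1)`) and `0 ≤ x ≤ 1/2`, the crossing pairing weighs at most the adjacent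
one: `Z((c₁,0),(c₃,0)) Z((c₂,0),(c₃,1)) ≤ Z((c₁,0),(c₂,0)) Z((c₃,0),(c₃,1))`. Mechanism: the
same-row kernel from `(c₁,0)` is non-increasing in the span (the zigzag sequences
`x^n (P^{n+1} ± M^{n+1})`, `x^n (P^n + M^n)` are non-increasing on `[0, 1/2]` and `E_{L-j}`
decreases with `j`), and the crossing kernel into the rung column is at most
`x + E_{c₂} + E_{L-c₃}`, which is at most the rung `x + E_{c₃} + E_{L-c₃}` since `E_k` is monotone
in `k`. [folklore] -/
theorem stub_ladder_bbbt_rung_adjacent (L : ℕ) {c₁ c₂ c₃ : ℕ} (h₁₂ : c₁ < c₂) (h₂₃ : c₂ < c₃)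
    (h₃ : c₃ ≤ L) {x : ℝ} (hx0 : 0 ≤ x) (hx : x ≤ 1 / 2) :
    pathKernel (discreteDomainGraph (rectDomain L 1) 1) x (st c₁ 0) (st c₃ 0) *
        pathKernel (discreteDomainGraph (rectDomain L 1) 1) x (st c₂ 0) (st c₃ 1) ≤
      pathKernel (discreteDomainGraph (rectDomain L 1) 1) x (st c₁ 0) (st c₂ 0) *
        pathKernel (discreteDomainGraph (rectDomain L 1) 1) x (st c₃ 0) (st c₃ 1) := by
  obtain ⟨u, hu⟩ : ∃ u, c₁ + u + 1 = c₂ := ⟨c₂ - c₁ - 1, by omega⟩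
  obtain ⟨m, hm⟩ : ∃ m, c₂ + m + 1 = c₃ := ⟨c₃ - c₂ - 1, by omega⟩
  have hE := fun k => rungAdj_E_nonneg hx0 k
  rw [rungAdj_kernel_same L c₁ c₃ (u + m + 1) (by omega) h₃ hx0,
    rungAdj_kernel_cross L c₂ c₃ m hm h₃ hx0,
    rungAdj_kernel_same L c₁ c₂ u hu (by omega) hx0, stub_ladderRung L c₃ h₃ hx0,
    ← ENNReal.ofReal_mul (rungAdj_same_nonneg (u + m + 1) hx0 (by linarith) (hE c₁) (hE (L - c₃))),
    ← ENNReal.ofReal_mul (rungAdj_same_nonneg u hx0 (by linarith) (hE c₁) (hE (L - c₂)))]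
  exact ENNReal.ofReal_le_ofReal (rungAdj_real u m hx0 hx (hE c₁) (hE c₂) (rungAdj_E_le hx0 hx c₂)
    (hE (L - c₂)) (hE (L - c₃)) (rungAdj_E_mono hx0 (by omega : c₂ ≤ c₃))
    (rungAdj_E_mono hx0 (by omega : L - c₃ ≤ L - c₂)))

end Summit.CriticalPhenomena.SAWScalingLimit.Theorems.BoundaryTP2
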